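import Literature.AlgebraicGeometry.Motives.HodgeStructureHodgeGroupCenter
import Literature.AlgebraicGeometry.Motives.HodgeStructureLefschetzGroupCenterFinite
import Literature.AlgebraicGeometry.Motives.HodgeTensorHomothetyMemMumfordTateGroupProofs
import HarnessLib

/-!
# THE CENTRE OF THE HODGE GROUP SITS IN MILNE'S `S₀ = U_{C₀}`: «the center `Z(Hdg)` of the Hodge group is contained in the torus
# `U_E`»; for `†` of the first kind on `C₀` (no factor of type IV: «the Hodge group `Hdg(X)` is semi-simple») the `ℚ`-points
# `Z(Hg(H)(ℚ))` form a FINITE elementary abelian `2`-group of order dividing `2^t`; by contrast `Z(MT(H)(ℚ)) ⊇ ℚ^×` is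
# infinite in weight `≠ 0` (Moonen–Zarhin 1998 §1; Milne 1999 §1; Deligne 1982 I §3)

[topic AlgebraicGeometry/Motives]

Layer `Literature/AlgebraicGeometry/Motives`, lane `lit-hodgefound` (Track 2 foundations library; prover seat
`lit-hodgefound-p02`, generation 54, self-proposed row g54-#11). THEOREMS ONLY: no definition, no named fact (net debt `0`),
no instance, no notation.  Sequel of g54-#7 (`Motives/HodgeStructureHodgeGroupCenter`: `Z(Hg(H)(ℚ)) = Hg ∩ E_φ`, and
`Z(Hg(H)(ℚ)) ⊆ Z(S(H)(ℚ))` along `Hg ≤ S`) and g54-#8 (`Motives/HodgeStructureLefschetzGroupCenterFinite`: `Z(S(H)(ℚ)) ≅ S₀(ℚ) =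
{z ∈ C₀ | z† z = 1}`, of order `2^t` for `†` of the first kind).  Moonen–Zarhin (§1, proof of Criterion (2) ⟹ (3)): «the
center `Z(Hdg)` of the Hodge group is contained in the torus `U_E`», and (§1, p. 1): «If `X` has no factors of type 4 then the
Hodge group `Hdg(X)` is semi-simple (see [Chi])».  On `ℚ`-points, for a polarized `ℚ`-Hodge structure `(H, ψ)`:
(i) the inclusion `Hg(H)(ℚ) ≤ S(H)(ℚ)` restricts to an INJECTIVE GROUP HOMOMORPHISM `Z(Hg(H)(ℚ)) → Z(S(H)(ℚ)) ≅ S₀(ℚ) = U_{C₀}(ℚ)`;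
(ii) if `†` is the identity on `C₀ = Z(E_φ)` (types I–III — «no factors of type 4») then every central `γ ∈ Hg(H)(ℚ)` is an
involution, `Z(Hg(H)(ℚ))` is FINITE and `#Z(Hg(H)(ℚ))` divides `2^t` (`t` = the number of simple factors of `E_φ`, g54-#8); for
a totally real FIELD centre, `Z(Hg(H)(ℚ)) ⊆ {±1}`;
(iii) the Mumford–Tate group: in weight `n ≠ 0` every homothety `c · id`, `c ∈ ℚ^×`, is a CENTRAL element of `MT(H)(ℚ)`
(the tree's discharged fact `homothety_mem_mumfordTateGroup`, Deligne I 3.4), so `Z(MT(H)(ℚ))` is INFINITE as soon as `V ≠ 0`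
— `MT = 𝔾_m · Hg` has at least a one-dimensional split central torus.
Honest scope: these are statements about the `ℚ`-POINTS of the centres (the tree's `H.hodgeGroup`, `H.mumfordTateGroup` are
the groups of `ℚ`-points); finiteness of `Z(Hg)(ℚ)` is the shadow on rational points of «`Hdg` semi-simple».

## The sources, verbatim

* B. J. J. Moonen, Yu. G. Zarhin, *Weil classes on abelian varieties*, J. reine angew. Math. 496 (1998) 83–92
  [MoonenZarhin1998WeilClasses] (held `paper:arxiv-alg-geom_9612017`): chunk p0001 L111–L112 «If `X` has no factors of type 4
  then the Hodge group `Hdg(X)` is semi-simple (see [Chi]), hence contained in `Sl_F(V_X)`»; chunk p0004 L54–L57 «let us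
  recall that the center `Z(Hdg)` of the Hodge group is contained in the torus `U_E`, and that the action of `Hdg` on `W_F`
  is given by the `F`-linear determinant. Therefore, if `E ⊂ F′`, then `W_{F′}` consists of Hodge classes if and only if `Hdg`
  is semi-simple.»; chunk p0002 L121–L127 (Lemma (1): `U_{K_B}` «a connected torus […]; in all other cases it is finite»).
* J. S. Milne, *Lefschetz classes on abelian varieties*, Duke Math. J. 96 (1999) 639–675 [Milne1999LefschetzClasses] (held
  `paper:doi-10-1215-s0012-7094-99-09620-5`): p. 645 L8–L14 (`S₀(A)(R) = {γ ∈ C₀(A) ⊗_ℚ R | γ†γ = 1}`, Prop. 1.7); §4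
  p. 660 L27–L35 («`L(A) ⊃ Hg(A)`», «`MT(A)` […] generated by `Hg(A)` and the homotheties»).
* P. Deligne, *Hodge cycles on abelian varieties*, LNM 900 (1982) [Deligne1982HodgeCycles], I §3 Prop. 3.4 and 3.6 (`MT`,
  the homotheties `h(𝔾_m)`).

Nearest tree results, BY NAME (other carriers): for complex abelian varieties on `H¹(A(ℂ); ℂ)`,
`Literature/AlgebraicGeometry/HodgeTheory/HodgeGroupSemisimpleOfNoTypeIVFactor`, `…/LefschetzGroupCentreHodgeGroupCentre`
(`map_center_hodgeGroupOne_le_map_center_unitaryCentralizerGroup`: «`Z(Hdg) ⊂ U_E`»), `…/WeilClassesFieldHodgeSemisimpleHodgeGroup`,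
`VanGeemen1994.finite_center_hodgeGroup_of_hodgeGroupOne`; here the abstract polarized `ℚ`-Hodge structure and the groups
of `ℚ`-points `H.hodgeGroup`, `H.mumfordTateGroup`, `ψ.lefschetzGroup`.

## Dictionary and what is proved (namespace `Literature.AlgebraicGeometry.Motives.HodgeStructure`)

`Hg(H)(ℚ) = H.hodgeGroup`, `MT(H)(ℚ) = H.mumfordTateGroup`, `S(H)(ℚ) = ψ.lefschetzGroup` (subgroups of `GL(V)`), `C₀ = Z(E_φ) =
Subalgebra.center ℚ H.endAlg`, `†` = `ψ.adjoint`, `t` = `Nat.card {S // S minimal non-zero E_φ-stable}`; `[HodgeTensorFacts]`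
is the standing instance hypothesis through which the tree defines `Hg` and `MT`.

* §1 **`Polarization.exists_center_hodgeGroup_monoidHom_injective`** (an injective group hom `Z(Hg(H)(ℚ)) →* Z(S(H)(ℚ))` over
  the inclusion — «`Z(Hdg) ⊂ U_E`» on `ℚ`-points, with g54-#8's `Z(S(H)(ℚ)) ≅ U_{C₀}(ℚ)`).
* §2 FIRST KIND: **`Polarization.mul_self_eq_one_of_mem_center_hodgeGroup`** (central elements of `Hg(H)(ℚ)` are involutions),
  **`Polarization.finite_center_hodgeGroup_of_forall_adjoint_eq_self`** (`Z(Hg(H)(ℚ))` is finite),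
  **`Polarization.natCard_center_hodgeGroup_dvd_two_pow`** (`#Z(Hg(H)(ℚ)) ∣ 2^t`),
  `Polarization.coe_eq_one_or_eq_neg_one_of_mem_center_hodgeGroup` (totally real field centre: `Z(Hg(H)(ℚ)) ⊆ {±1}`).
* §3 `MT`: **`smulOfUnit_mem_center_mumfordTateGroup`** (weight `≠ 0`: the homotheties are central elements of `MT(H)(ℚ)`),
  **`infinite_center_mumfordTateGroup`** (`V ≠ 0`, weight `≠ 0`: `Z(MT(H)(ℚ))` is infinite).
-/

noncomputable section

open NumberField

namespace Literature.AlgebraicGeometry.Motives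

namespace HodgeStructure

universe u

variable {V : Type u} [AddCommGroup V] [Module ℚ V] [Module.Finite ℚ V] [HodgeTensorFacts.{u, u}] {n : ℤ}
  {H : HodgeStructure V n}

/-! ## §1 «`Z(Hdg) ⊂ U_E`»: `Z(Hg(H)(ℚ)) ↪ Z(S(H)(ℚ))` as groups -/

/-- **«THE CENTER `Z(Hdg)` OF THE HODGE GROUP IS CONTAINED IN THE TORUS `U_E`», ON `ℚ`-POINTS**: the inclusion
`Hg(H)(ℚ) ≤ S(H)(ℚ)` restricts to an injective group homomorphism `Z(Hg(H)(ℚ)) →* Z(S(H)(ℚ))` (g54-#7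
`Polarization.inclusion_mem_center_lefschetzGroup`; `Z(S(H)(ℚ)) ≅ S₀(ℚ) = U_{C₀}(ℚ)` by g54-#8
`Polarization.bijOn_coe_center_lefschetzGroup`). [cite: MoonenZarhin1998WeilClasses, §1 (proof of (2) ⟹ (3): «Z(Hdg) ⊂ U_E»)]
[cite: Milne1999LefschetzClasses, §1 p. 645 L8–L14 and §4 p. 660 L27–L35] -/
theorem Polarization.exists_center_hodgeGroup_monoidHom_injective (ψ : Polarization H) :
    ∃ f : Subgroup.center H.hodgeGroup →* Subgroup.center ψ.lefschetzGroup, Function.Injective f ∧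
      ∀ γ : Subgroup.center H.hodgeGroup,
        (((f γ : Subgroup.center ψ.lefschetzGroup) : ψ.lefschetzGroup) : V ≃ₗ[ℚ] V) =
          ((γ : Subgroup.center H.hodgeGroup) : H.hodgeGroup) := by
  refine ⟨((Subgroup.inclusion ψ.hodgeGroup_le_lefschetzGroup).comp (Subgroup.center H.hodgeGroup).subtype).codRestrict
      (Subgroup.center ψ.lefschetzGroup) fun γ => ψ.inclusion_mem_center_lefschetzGroup γ.2, fun γ γ' h => ?_,
    fun γ => rfl⟩
  have h1 := congrArg (fun x : Subgroup.center ψ.lefschetzGroup => ((x : ψ.lefschetzGroup) : V ≃ₗ[ℚ] V)) h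
  exact Subtype.ext (Subtype.ext h1)

/-! ## §2 First kind (no factor of type IV): `Z(Hg(H)(ℚ))` is a finite elementary abelian `2`-group, `#Z ∣ 2^t` -/

/-- **`†` OF THE FIRST KIND ⟹ EVERY CENTRAL ELEMENT OF `Hg(H)(ℚ)` IS AN INVOLUTION** (it is a central element of `S(H)(ℚ)`,
g54-#7, where g54-#5 `Polarization.mul_self_eq_one_of_mem_center_lefschetzGroup` applies).
[cite: MoonenZarhin1998WeilClasses, §1 («Z(Hdg) ⊂ U_E»; Lemma (1))] [cite: Milne1999LefschetzClasses, §1 p. 645 L1–L14] -/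
theorem Polarization.mul_self_eq_one_of_mem_center_hodgeGroup (ψ : Polarization H)
    (hfix : ∀ z : H.endAlg, z ∈ Subalgebra.center ℚ H.endAlg → ψ.adjoint (z : Module.End ℚ V) = z)
    {γ : H.hodgeGroup} (hγ : γ ∈ Subgroup.center H.hodgeGroup) : γ * γ = 1 := by
  have h := ψ.mul_self_eq_one_of_mem_center_lefschetzGroup hfix (ψ.inclusion_mem_center_lefschetzGroup hγ)
  apply Subgroup.inclusion_injective ψ.hodgeGroup_le_lefschetzGroup
  rw [map_mul, map_one]
  exact h

/-- **«IF `X` HAS NO FACTORS OF TYPE 4 THEN `Hdg(X)` IS SEMI-SIMPLE», ON `ℚ`-POINTS: `Z(Hg(H)(ℚ))` IS FINITE** when `†` is the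
identity on `C₀` — it embeds in the finite group `Z(S(H)(ℚ)) ≅ U_{C₀}(ℚ) = μ₂^t` (g54-#8).
[cite: MoonenZarhin1998WeilClasses, §1 p. 1 («Hdg(X) is semi-simple (see [Chi])») and Lemma (1)]
[cite: Milne1999LefschetzClasses, §1 p. 645 L1–L14 and §2 Summary p. 652] -/
theorem Polarization.finite_center_hodgeGroup_of_forall_adjoint_eq_self (ψ : Polarization H)
    (hfix : ∀ z : H.endAlg, z ∈ Subalgebra.center ℚ H.endAlg → ψ.adjoint (z : Module.End ℚ V) = z) :
    Finite (Subgroup.center H.hodgeGroup) := by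
  haveI := ψ.finite_center_lefschetzGroup_of_forall_adjoint_eq_self hfix
  obtain ⟨f, hf, -⟩ := ψ.exists_center_hodgeGroup_monoidHom_injective
  exact Finite.of_injective f hf

/-- **`#Z(Hg(H)(ℚ))` DIVIDES `2^t`** (`t` = the number of simple factors of `E_φ`) when `†` is the identity on `C₀`: Lagrange along
the injective homomorphism `Z(Hg(H)(ℚ)) →* Z(S(H)(ℚ))` and g54-#8's `#Z(S(H)(ℚ)) = 2^t`.
[cite: MoonenZarhin1998WeilClasses, §1 («Z(Hdg) ⊂ U_E»; Lemma (1))] [cite: Milne1999LefschetzClasses, §1 p. 645 L1–L14 and §2 Summary p. 652] -/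
theorem Polarization.natCard_center_hodgeGroup_dvd_two_pow (ψ : Polarization H)
    (hfix : ∀ z : H.endAlg, z ∈ Subalgebra.center ℚ H.endAlg → ψ.adjoint (z : Module.End ℚ V) = z) :
    Nat.card (Subgroup.center H.hodgeGroup) ∣
      2 ^ Nat.card {S : SubHodgeStructure H // (∀ a ∈ H.endAlg, ∀ v ∈ S.toSubmodule, a v ∈ S.toSubmodule) ∧
        S.toSubmodule ≠ ⊥ ∧ ∀ S' : SubHodgeStructure H, (∀ a ∈ H.endAlg, ∀ v ∈ S'.toSubmodule, a v ∈ S'.toSubmodule) →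
          S'.toSubmodule ≤ S.toSubmodule → S'.toSubmodule = ⊥ ∨ S'.toSubmodule = S.toSubmodule} := by
  obtain ⟨f, hf, -⟩ := ψ.exists_center_hodgeGroup_monoidHom_injective
  rw [← ψ.natCard_center_lefschetzGroup_eq_two_pow hfix]
  exact Subgroup.card_dvd_of_injective f hf

/-- **TOTALLY REAL FIELD CENTRE (isotypic, types I–III): `Z(Hg(H)(ℚ)) ⊆ {±1}`** (g54-#5
`Polarization.mem_center_lefschetzGroup_iff_of_isTotallyReal` on the inclusion). [cite: MoonenZarhin1998WeilClasses, §1 («Z(Hdg) ⊂ U_E»)]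
[cite: Milne1999LefschetzClasses, §2 p. 646 L10–L16] [cite: Lange2023AbelianVarietiesComplex, §2.6.2 Lemma 2.6.4] -/
theorem Polarization.coe_eq_one_or_eq_neg_one_of_mem_center_hodgeGroup {K : Type*} [Field K] [NumberField K]
    (ψ : Polarization H) (g : K ≃+* Subring.center H.endAlg) (hK : IsTotallyReal K)
    {γ : H.hodgeGroup} (hγ : γ ∈ Subgroup.center H.hodgeGroup) :
    ((γ : V ≃ₗ[ℚ] V) : Module.End ℚ V) = 1 ∨ ((γ : V ≃ₗ[ℚ] V) : Module.End ℚ V) = -1 :=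
  (ψ.mem_center_lefschetzGroup_iff_of_isTotallyReal g hK (Subgroup.inclusion ψ.hodgeGroup_le_lefschetzGroup γ)).1
    (ψ.inclusion_mem_center_lefschetzGroup hγ)

/-! ## §3 The Mumford–Tate group: the homotheties are central, so `Z(MT(H)(ℚ))` is infinite (weight `≠ 0`, `V ≠ 0`) -/

/-- **THE HOMOTHETIES ARE CENTRAL IN `MT(H)(ℚ)`** (weight `n ≠ 0`): `c · id ∈ MT(H)(ℚ)` for `c ∈ ℚ^×` (the tree's discharged
fact `homothety_mem_mumfordTateGroup`, Deligne I 3.4: `h(𝔾_m) ⊂ MT`), and it commutes with every element of `GL(V)`.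
[cite: Deligne1982HodgeCycles, I §3 Prop. 3.4 and 3.6] [cite: Milne1999LefschetzClasses, §4 p. 660 L27–L35] -/
theorem smulOfUnit_mem_center_mumfordTateGroup (hn : n ≠ 0) (c : ℚˣ) :
    (⟨LinearEquiv.smulOfUnit c, homothety_mem_mumfordTateGroup_holds H hn c⟩ : H.mumfordTateGroup) ∈
      Subgroup.center H.mumfordTateGroup := by
  rw [Subgroup.mem_center_iff]
  intro g
  apply Subtype.ext
  refine LinearEquiv.ext fun v => ?_
  show (g : V ≃ₗ[ℚ] V) (LinearEquiv.smulOfUnit c v) = LinearEquiv.smulOfUnit c ((g : V ≃ₗ[ℚ] V) v)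
  simp only [LinearEquiv.smulOfUnit, DistribMulAction.toLinearEquiv_apply, Units.smul_def, map_smul]

/-- **`Z(MT(H)(ℚ))` IS INFINITE** (weight `n ≠ 0`, `V ≠ 0`): `c ↦ c · id` embeds the infinite group `ℚ^×` in the centre of
`MT(H)(ℚ)` — `MT` contains the central torus of homotheties, so (unlike `Hg` or `S`) its centre is never finite.
[cite: Deligne1982HodgeCycles, I §3 Prop. 3.4 and 3.6] [cite: Milne1999LefschetzClasses, §4 p. 660 L27–L35] -/
theorem infinite_center_mumfordTateGroup [Nontrivial V] (hn : n ≠ 0) : Infinite (Subgroup.center H.mumfordTateGroup) := by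
  haveI : Infinite ℚˣ :=
    Infinite.of_injective (fun k : ℕ => Units.mk0 ((k : ℚ) + 1) (by positivity)) fun a b h => by
      have h' := congrArg Units.val h
      simp only [Units.val_mk0, add_left_inj, Nat.cast_inj] at h'
      exact h'
  obtain ⟨v, hv⟩ := exists_ne (0 : V)
  refine Infinite.of_injective (fun c : ℚˣ => (⟨⟨LinearEquiv.smulOfUnit c, homothety_mem_mumfordTateGroup_holds H hn c⟩,
    smulOfUnit_mem_center_mumfordTateGroup hn c⟩ : Subgroup.center H.mumfordTateGroup)) fun c c' h => ?_
  have h1 : (LinearEquiv.smulOfUnit c : V ≃ₗ[ℚ] V) v = (LinearEquiv.smulOfUnit c' : V ≃ₗ[ℚ] V) v := by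
    have h2 := congrArg (fun x : Subgroup.center H.mumfordTateGroup => ((x : H.mumfordTateGroup) : V ≃ₗ[ℚ] V)) h
    exact LinearEquiv.congr_fun h2 v
  simp only [LinearEquiv.smulOfUnit, DistribMulAction.toLinearEquiv_apply, Units.smul_def] at h1
  exact Units.ext (smul_left_injective ℚ hv h1)

end HodgeStructure

end Literature.AlgebraicGeometry.Motives
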